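import Mathlib
import Summits.ValiantsHypothesis.ValiantsHypothesis.Theses.RigidityForcesSymmetry
import Summits.ValiantsHypothesis.ValiantsHypothesis.Theorems.RigidityForcesSymmetryRankRigidMinimalReprLaplaceFiveSeparatedCapture

/-!
# ValiantsHypothesis / RigidityForcesSymmetry — crux `LaplaceOptimalFive` (stmt-ValiantsHypothesis-24813), crux idea
`separated-capture` (val-idea-19 g8) — part 3/3: THE CONVERSE CONSTRUCTION and the glue to the Theses decl

PORT of the crux workfile `Cruxes/LaplaceOptimalFive/SeparatedCaptureSketch.lean` r4 (sha16 b3584f027d45cbd3, 817 l., farm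
rc 0 / 0 sorry) — proof texts VERBATIM; namespace `…Cruxes.LaplaceOptimalFive.SeparatedCapture` ↦
`…Theorems.RigidityForcesSymmetryRankRigidMinimalRepr.LaplaceFiveSeparatedCapture`; split by the 400-line cap into
`…SeparatedCaptureDefs` (vocabulary + coordinate machinery) → `…SeparatedCapture` (the two forward lemmas) →
`…SeparatedCaptureViolation` (the converse construction + the glue to the Theses decl); DEDUP: the sketch's `weight` is
byte-identical to ✓ `LaplaceFiveSectorSplit.laplaceWeight` and is replaced by it (import, two `unfold`s renamed) — nothing else of
the landed `…LaplaceFive*` files is restated (`Cylindrical` = conjuncts 1–2 of `IsSplitDecomposition`, kept as the sketch's own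
hypothesis shape).

THIS MODULE.  ★ `stub_violation_honest`: a violation of `CaptureIneq` yields an EXPLICIT exact cylindrical system on a
{3,4}-separated pair profile of Laplace weight `≤ 108 = 9·12` (coordinates `P`, the Laplace identity `laplace34`, capture
unpacking over bases via `Phi`/`L3_le_range`, the adapted basis of `ℂ¹⁰`; see the docstring).  `separated_of_laplaceOptimalFive`:
the separated case is a sub-case of the Theses decl `…Theses.RigidityForcesSymmetry.LaplaceOptimalFive` (the honest direction).
★ `violation_refutes (hv : ¬ CaptureIneq) : ¬ LaplaceOptimalFive` — so `CaptureIneq` ⟺ the crux on {3,4}-separated pair profiles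
is a kernel EQUIVALENCE (with part 2), and a violating triangle configuration would REFUTE the crux.  This is an INSTRUMENT (R309
(6)(i) / R311: rung under S2′/S3′ of LINE `shallow_collision`, not a second line); it decides nothing by itself.

Honest framing.  CONDITIONAL helper rows / an INSTRUMENT for an OPEN crux: `CaptureIneq` itself is OPEN; `LaplaceOptimalFive`
(stmt-ValiantsHypothesis-24813, OPEN · CONTESTED 72/120), `RankRigidMinimalRepr`, `VP ≠ VNP` are NOT proved; no summit statement is
proved by this port.  Credit: statements + proofs val-idea-19 g8 (crux idea #8 `separated-capture`, card
`Cruxes/LaplaceOptimalFive/Ideas/separated-capture.md`, referee val-idea-crit-3 g5); port val-port-4 g3 (desk RULING #358 (A)).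
-/

set_option linter.dupNamespace false

namespace Summit.ValiantsHypothesis.ValiantsHypothesis.Theorems.RigidityForcesSymmetryRankRigidMinimalRepr

namespace LaplaceFiveSeparatedCapture

open Finset LaplaceFiveSectorSplit

set_option maxHeartbeats 4000000 in
/-- CONVERSE (PROVED, r4), in refuter-standard shape (crit-3 g5 21:55:45Z (a)): a violation of `CaptureIneq` is an EXACT cheap term
system — the three clauses of the crux's `hdec` (both cylinder conditions, exactness on all 3125 words) on a {3,4}-separated pair profile,
weight counted `≤ 108 = 9·12`.  EXPLICIT CONSTRUCTION (no limits, no genericity), as formalised: coordinates `P = {(s,t) : s < t}` (≅ the ten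
3-subsets by complement), `y_π := Lsym e_π` the symmetric pair indicators, `x_π(p,q,r) := P₅(p,q,r,π₁,π₂)` the arrangement tensors, and the
{3,4} | {0,1,2} Laplace identity `P₅(p,q,r,s,t) = Σ_π x_π(p,q,r) · y_π(s,t)` (`laplace34`).  Given triangle spans `U_ab` (bases `b^{ab}`, `m_Δ`
forms) and a captured symmetric zero-diagonal `W` of dimension `k ≥ m_Δ + 1`: the obligation vectors `ν(μ_i) ∈ ℂ^P` of a basis `μ_i` of `W` are
linearly independent (`ν` is injective on symmetric zero-diagonal matrices); complete them through a complement `Q` (dim `10 − k`) to a basis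
`bE` of `ℂ^P` and rewrite the identity tensor `Σ_π e^π ⊗ e_π = Σ_J bE_J ⊗ bE^J`: `P₅ = Σ_J X_J ⊗ Y_J` with `X_J := Σ_π (bE J)_π x_π`,
`Y_J := Lsym (J-th coordinate row)`.  The `W`-block has `X_{inl i} = Σ_π ν(μ_i)_π x_π = T_{μ_i}` (`contractZ_expand`), which is CAPTURED, i.e. in the
range of the regrouping map `Phi` over the bases `b^{ab}` (`L3_le_range`): `T_{μ_i} = Σ_l b^{01}_l ⊗₂ g¹_{il} + Σ_l b^{02}_l ⊗₁ g²_{il} + Σ_l b^{12}_l ⊗₀ g³_{il}`;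
summing over `i` and regrouping gives ONE TRIANGLE TERM per basis form `b^{ab}_l` (long factor `Σ_i g_{il} ⊗ Y_{inl i}` on slots c,3,4); the
`Q`-block gives `10 − k` LEAF TERMS `Y_{inr j} ⊗ X_{inr j}`.  Terms: `(10 − k) + m_Δ ≤ 9`, each of weight `2!·3! = 12`, so weight `≤ 108`.
Composed with the crux this is a conditional refutation (`violation_refutes`, below). -/
theorem stub_violation_honest :
    ¬ CaptureIneq →
    ∃ (N : ℕ) (T : Finset (Fin N)) (S : Fin N → Finset (Fin 5)) (u w : Fin N → (Fin 5 → Fin 5) → ℂ),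
      Cylindrical S u w ∧ (∀ v : Fin 5 → Fin 5, (∑ t ∈ T, u t v * w t v) = perm5 v) ∧ SepProfile34 T S ∧
      laplaceWeight T S ≤ 108 := by
  intro hnc
  classical
  unfold CaptureIneq at hnc
  push Not at hnc
  obtain ⟨U01, U02, U12, W, hWs, hWd, hWc, hlt⟩ := hnc
  -- bases of the four spaces
  let b1 := Module.finBasis ℂ U01
  let b2 := Module.finBasis ℂ U02
  let b3 := Module.finBasis ℂ U12
  let bW := Module.finBasis ℂ W
  -- the obligation vectors of a basis of `W` are independent in `P → ℂ`; complete them to a basis through a complement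
  let f0 : Fin (Module.finrank ℂ W) → (P → ℂ) := fun i => nuL (bW i : Fin 5 → Fin 5 → ℂ)
  have hli : LinearIndependent ℂ f0 := nu_basis_linearIndependent W hWs hWd bW
  let Nsp : Submodule ℂ (P → ℂ) := Submodule.span ℂ (Set.range f0)
  obtain ⟨Q, hQ⟩ := Nsp.exists_isCompl
  let bN : Module.Basis (Fin (Module.finrank ℂ W)) ℂ Nsp := Module.Basis.span hli
  let bQ : Module.Basis (Fin (Module.finrank ℂ Q)) ℂ Q := Module.finBasis ℂ Q
  let bE : Module.Basis (Fin (Module.finrank ℂ W) ⊕ Fin (Module.finrank ℂ Q)) ℂ (P → ℂ) :=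
    (bN.prod bQ).map (Submodule.prodEquivOfIsCompl Nsp Q hQ)
  have hbE_inl : ∀ i, bE (Sum.inl i) = f0 i := by
    intro i
    simp [bE, bN, Module.Basis.map_apply]
    exact congrArg Subtype.val (Module.Basis.span_apply hli i)
  have hdim : Module.finrank ℂ W + Module.finrank ℂ Q = 10 := by
    have h1 : Module.finrank ℂ Nsp = Module.finrank ℂ W := by
      rw [finrank_span_eq_card hli, Fintype.card_fin]
    have h2 := Submodule.finrank_add_eq_of_isCompl hQ
    rw [h1, Module.finrank_fintype_fun_eq_card, card_P] at h2
    exact h2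
  -- capture unpacking
  have hcapt : ∀ i : Fin (Module.finrank ℂ W), ∃ g,
      Phi (fun l => (b1 l : Fin 5 → Fin 5 → ℂ)) (fun l => (b2 l : Fin 5 → Fin 5 → ℂ)) (fun l => (b3 l : Fin 5 → Fin 5 → ℂ)) g
        = contractZ (bW i : Fin 5 → Fin 5 → ℂ) := by
    intro i
    exact LinearMap.mem_range.1 (L3_le_range U01 U02 U12 b1 b2 b3 (hWc _ (bW i).2))
  choose g hg using hcapt
  -- long / short factors of the rewritten Laplace identity
  let X : (Fin (Module.finrank ℂ W) ⊕ Fin (Module.finrank ℂ Q)) → Fin 5 → Fin 5 → Fin 5 → ℂ :=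
    fun J p q r => ∑ π : P, bE J π * xT π p q r
  let Y : (Fin (Module.finrank ℂ W) ⊕ Fin (Module.finrank ℂ Q)) → Fin 5 → Fin 5 → ℂ :=
    fun J => Lsym (fun π' => bE.repr (Pi.single π' 1) J)
  have hY : ∀ (π : P) (s t : Fin 5), Lsym (Pi.single π 1) s t = ∑ J, bE J π * Y J s t := by
    intro π s t
    rw [Lsym_lincomb]
    congr 1
    funext π'
    have h := congr_fun (bE.sum_repr (Pi.single π' (1:ℂ))) π
    simp only [Finset.sum_apply, Pi.smul_apply, smul_eq_mul] at h
    rw [show (Pi.single π (1:ℂ) : P → ℂ) π' = (Pi.single π' (1:ℂ) : P → ℂ) π from by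
      simp [Pi.single_apply, eq_comm], ← h]
    exact Finset.sum_congr rfl fun J _ => mul_comm _ _
  have key : ∀ p q r s t : Fin 5, perm5 (word p q r s t) = ∑ J, X J p q r * Y J s t := by
    intro p q r s t
    rw [laplace34]
    simp_rw [hY, Finset.mul_sum]
    rw [Finset.sum_comm]
    refine Finset.sum_congr rfl fun J _ => ?_
    simp only [X, Finset.sum_mul]
    exact Finset.sum_congr rfl fun π _ => by ring
  have hXinl : ∀ i p q r, X (Sum.inl i) p q r = contractZ (bW i : Fin 5 → Fin 5 → ℂ) p q r := by
    intro i p q r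
    simp only [X, hbE_inl, f0, nuL_apply]
    rw [contractZ_expand]
  -- the term system, indexed by a sum type
  let Jt := Fin (Module.finrank ℂ Q) ⊕ (Fin (Module.finrank ℂ U01) ⊕ (Fin (Module.finrank ℂ U02) ⊕ Fin (Module.finrank ℂ U12)))
  let St : Jt → Finset (Fin 5) := Sum.elim (fun _ => {3, 4})
    (Sum.elim (fun _ => {0, 1}) (Sum.elim (fun _ => {0, 2}) (fun _ => {1, 2})))
  let ut : Jt → (Fin 5 → Fin 5) → ℂ := Sum.elim (fun j v => Y (Sum.inr j) (v 3) (v 4))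
    (Sum.elim (fun l v => (b1 l : Fin 5 → Fin 5 → ℂ) (v 0) (v 1))
      (Sum.elim (fun l v => (b2 l : Fin 5 → Fin 5 → ℂ) (v 0) (v 2))
        (fun l v => (b3 l : Fin 5 → Fin 5 → ℂ) (v 1) (v 2))))
  let wt : Jt → (Fin 5 → Fin 5) → ℂ := Sum.elim (fun j v => X (Sum.inr j) (v 0) (v 1) (v 2))
    (Sum.elim (fun l v => ∑ i, (g i).1 l (v 2) * Y (Sum.inl i) (v 3) (v 4))
      (Sum.elim (fun l v => ∑ i, (g i).2.1 l (v 1) * Y (Sum.inl i) (v 3) (v 4))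
        (fun l v => ∑ i, (g i).2.2 l (v 0) * Y (Sum.inl i) (v 3) (v 4))))
  let e : Jt ≃ Fin (Fintype.card Jt) := Fintype.equivFin Jt
  refine ⟨Fintype.card Jt, Finset.univ, St ∘ e.symm, ut ∘ e.symm, wt ∘ e.symm, ?_, ?_, ?_, ?_⟩
  · -- cylindrical
    constructor
    · intro t v v' hvv'
      simp only [Function.comp_apply] at hvv' ⊢
      generalize e.symm t = j at hvv' ⊢
      rcases j with j | l | l | l <;> simp only [St, ut, Sum.elim_inl, Sum.elim_inr] at hvv' ⊢
      · rw [hvv' 3 (by simp), hvv' 4 (by simp)]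
      · rw [hvv' 0 (by simp), hvv' 1 (by simp)]
      · rw [hvv' 0 (by simp), hvv' 2 (by simp)]
      · rw [hvv' 1 (by simp), hvv' 2 (by simp)]
    · intro t v v' hvv'
      simp only [Function.comp_apply] at hvv' ⊢
      generalize e.symm t = j at hvv' ⊢
      rcases j with j | l | l | l <;> simp only [St, wt, Sum.elim_inl, Sum.elim_inr] at hvv' ⊢
      · rw [hvv' 0 (by decide), hvv' 1 (by decide), hvv' 2 (by decide)]
      · rw [hvv' 2 (by decide), hvv' 3 (by decide), hvv' 4 (by decide)]
      · rw [hvv' 1 (by decide), hvv' 3 (by decide), hvv' 4 (by decide)]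
      · rw [hvv' 0 (by decide), hvv' 3 (by decide), hvv' 4 (by decide)]
  · -- exact
    intro v
    rw [← word_eta v, key]
    simp only [word_eta]
    rw [show (∑ t ∈ (Finset.univ : Finset (Fin (Fintype.card Jt))), (ut ∘ e.symm) t v * (wt ∘ e.symm) t v)
        = ∑ j : Jt, ut j v * wt j v from by
          rw [← Equiv.sum_comp e.symm (fun j => ut j v * wt j v)]
          rfl]
    rw [Fintype.sum_sum_type, Fintype.sum_sum_type, Fintype.sum_sum_type, Fintype.sum_sum_type]
    simp only [ut, wt, Sum.elim_inl, Sum.elim_inr]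
    -- captured block: Σ_i X(inl i) Y(inl i) = the three triangle blocks
    have hblk : ∀ i, X (Sum.inl i) (v 0) (v 1) (v 2)
        = (∑ l, (b1 l : Fin 5 → Fin 5 → ℂ) (v 0) (v 1) * (g i).1 l (v 2))
          + (∑ l, (b2 l : Fin 5 → Fin 5 → ℂ) (v 0) (v 2) * (g i).2.1 l (v 1))
          + (∑ l, (b3 l : Fin 5 → Fin 5 → ℂ) (v 1) (v 2) * (g i).2.2 l (v 0)) := by
      intro i
      rw [hXinl, ← hg i, Phi_apply]
    simp_rw [hblk, add_mul, Finset.sum_add_distrib, Finset.sum_mul, Finset.mul_sum]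
    rw [Finset.sum_comm (f := fun l i => (b1 l : Fin 5 → Fin 5 → ℂ) (v 0) (v 1) * ((g i).1 l (v 2) * Y (Sum.inl i) (v 3) (v 4)))]
    rw [Finset.sum_comm (f := fun l i => (b2 l : Fin 5 → Fin 5 → ℂ) (v 0) (v 2) * ((g i).2.1 l (v 1) * Y (Sum.inl i) (v 3) (v 4)))]
    rw [Finset.sum_comm (f := fun l i => (b3 l : Fin 5 → Fin 5 → ℂ) (v 1) (v 2) * ((g i).2.2 l (v 0) * Y (Sum.inl i) (v 3) (v 4)))]
    have e3 : ∀ (a b c : ℂ), a * b * c = a * (b * c) := fun a b c => mul_assoc a b c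
    simp_rw [e3]
    rw [show (∑ x, Y (Sum.inr x) (v 3) (v 4) * X (Sum.inr x) (v 0) (v 1) (v 2))
        = ∑ x, X (Sum.inr x) (v 0) (v 1) (v 2) * Y (Sum.inr x) (v 3) (v 4) from
      Finset.sum_congr rfl (fun _ _ => mul_comm _ _)]
    ring
  · -- separated profile
    intro t _
    simp only [Function.comp_apply]
    generalize e.symm t = j
    rcases j with j | l | l | l <;> simp [St]
  · -- weight ≤ 108
    have hw : laplaceWeight Finset.univ (St ∘ e.symm) = ∑ t : Fin (Fintype.card Jt), 12 := by
      unfold laplaceWeight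
      refine Finset.sum_congr rfl fun t _ => ?_
      simp only [Function.comp_apply]
      generalize e.symm t = j
      rcases j with j | l | l | l <;> simp [St] <;> decide
    rw [hw, Finset.sum_const, Finset.card_univ, Fintype.card_fin, smul_eq_mul]
    have hcard : Fintype.card Jt = Module.finrank ℂ Q + (Module.finrank ℂ U01 + (Module.finrank ℂ U02 + Module.finrank ℂ U12)) := by
      simp [Jt, Fintype.card_sum, Fintype.card_fin]
    rw [hcard]
    omega

/-! ### Checked glue: the separated case IS a sub-case of the crux (the honest direction `S → C`). -/
/-- The separated case is a sub-case of the Theses decl `LaplaceOptimalFive` (the honest direction). [folklore] -/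
theorem separated_of_laplaceOptimalFive
    (h : Summit.ValiantsHypothesis.ValiantsHypothesis.Theses.RigidityForcesSymmetry.LaplaceOptimalFive) :
    ∀ (N : ℕ) (T : Finset (Fin N)) (S : Fin N → Finset (Fin 5)) (u w : Fin N → (Fin 5 → Fin 5) → ℂ),
      Cylindrical S u w → (∀ v : Fin 5 → Fin 5, (∑ t ∈ T, u t v * w t v) = perm5 v) → SepProfile34 T S →
      Nat.factorial 5 ≤ laplaceWeight T S := by
  intro N T S u w hc hex _
  exact h N T S u w hc.1 hc.2 (fun v => by simpa [perm5] using hex v)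

/-- PROVED COMPOSITION: a violation of the capture inequality refutes the crux (through `stub_violation_honest` only).
CONDITIONAL REFUTATION INSTRUMENT (desk RULING #360 lane): violation witness ⇒ ¬(the crux); NO witness is asserted anywhere in
the tree; this is not a refutation of any ledger item. -/
theorem violation_refutes (hv : ¬ CaptureIneq) :
    ¬ Summit.ValiantsHypothesis.ValiantsHypothesis.Theses.RigidityForcesSymmetry.LaplaceOptimalFive := by
  intro h
  obtain ⟨N, T, S, u, w, hc, hex, hsep, hwt⟩ := stub_violation_honest hv
  have h120 := separated_of_laplaceOptimalFive h N T S u w hc hex hsep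
  have h5 : Nat.factorial 5 = 120 := by decide
  omega

/-! ### Leaf rigidity (crit-3 g5 21:55:45Z (b)) — a COROLLARY of the elimination, not an imported lemma.
Honest decomposability with spans `(U_Δ, U₃₄)` ⟺ `N(U₃₄) ⊆ Cap(U_Δ)` where `N(U₃₄) := (U₃₄ ∩ Sym₀)^⊥ ⊂ Sym₀^*`: a functional `ψ` on `Sym₀`
extends to a matrix functional `μ` killing `U₃₄` iff `ψ` kills `U₃₄ ∩ Sym₀` (extend from `U₃₄ + Sym₀`), and `T_μ` depends on `μ` only through
`ψ = μ|_{Sym₀}` (antisymmetric and diagonal parts pair to zero with every `y_C`).  Hence decomposability depends on the leaf span only through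
`U₃₄ ∩ Sym₀`, and (⟹)+(⟸) rebuild from ANY honest separated system one with the same triangle spans, leaf span `U₃₄ ∩ Sym₀` (symmetric = leaf
side-symmetric, zero-diagonal = leaf on-shell) and weight `≤` the old weight.  No disjunct of S3′ and no ✓ tree lemma is invoked; the star / C₄
side-symmetry theorems (p665006, p669391) are about other profiles. -/

/-- Sanity: the obligation tensor of the elementary symmetric leaf matrix `e₃₄ + e₄₃` is the arrangement indicator of
`{0,1,2}` — value 1 at the injective triple `(0,1,2)`. -/
example : perm5 (word 0 1 2 3 4) = 1 := by
  simp [perm5, word]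
  decide


end LaplaceFiveSeparatedCapture

end Summit.ValiantsHypothesis.ValiantsHypothesis.Theorems.RigidityForcesSymmetryRankRigidMinimalRepr
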